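import Literature.Computability.AlgebraicComplexity.MS21ANFFirstDerivativeHitting
import Literature.Computability.AlgebraicComplexity.MS21SigmaPiOrbitsProofs
import Mathlib.RingTheory.MvPolynomial.EulerIdentity
import HarnessLib

/-!
# Medini–Shpilka 2021, Thm 35 (`thm:pitRoanf`) for `Δ₁ = Δ₂`: translations, the equal-span case,
# and the reduction of the typed statement to its homogeneous core

The typed literature statement `MS2021_thm_35` (`MS21DenseOrbitsHittingSets`): for `f₁ ∈ ANF_{Δ₁}
^{GLaff_n(F)}`, `f₂ ∈ ANF_{Δ₂}^{GLaff_n(F)}` with `f := f₁ - f₂ ≠ 0`, every UNIFORM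
`(2·max{Δ₁,Δ₂}+7)`-independent map `G` satisfies `f ∘ G ≠ 0`.  By-name partial results already in the
tree: `MS2021_thm_35_of_max_le_three` (`max ≤ 3`), `MS2021_thm_35_of_ne` (`Δ₁ ≠ Δ₂`),
`MS2021_thm_35_of_offBlock` (`Δ₁ = Δ₂`, the `x`-spans of the two affine maps differ = Case A).

This file (theorems only; no definitions, no new named facts, D-0026) finishes the AFFINE part of the
remaining case `Δ₁ = Δ₂ =: Δ` and isolates exactly the printed homogeneous core:

* **First-order Taylor components via Euler's identity** (`homogeneousComponent_affSubst_one`): for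
  `g` homogeneous of degree `d + 1`, `[g(y + β)]_d = Σ_i β_i ∂g/∂y_i` — from Euler's identity
  `Σ_i y_i ∂_i g = (d+1)·g` (Mathlib `IsHomogeneous.sum_X_mul_pderiv`) pushed through the translation
  and read in degree `d` (no division: `(d+1)•u = d•u + u`); this is the component computation used
  at arXiv p0030:L44–L52 ("`h^{[d-1]}` … `Σ_i (β₁ - β₂)_i ∂ANF/∂x_i`").
* **Book-keeping of affine substitutions** (`affSubst_eq_affSubst_zero_affSubst`,
  `affSubst_one_affSubst_zero`, `homogeneousComponent_affSubst_zero`): if the first `4^Δ` rows of `A₁`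
  are `M`-combinations of those of `A₂` then `ANF(A₁x + b₁) = P(A₂x)` with `P(y) = ANF(My + β₁)`;
  `y ↦ y + γ` after `y ↦ My` is `y ↦ My + Mγ`; linear substitutions commute with taking homogeneous
  components. [cite: MediniShpilka2021, §1.1.6 (CCC p.19:9) and proof of Thm 35, arXiv p0030:L33–L43]
* **Case B2 = equal spans and `ANF_Δ(My) = ANF_Δ(y)`** (`MS2021_thm_35_of_rowSpan_symm`): then
  `ANF(My + β₁) = ANF(y + M⁻¹β₁)`, so `f = P(A₂x)` with `P = ANF(y + γ) - ANF(y + β₂)`, `γ ≠ β₂`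
  (as `f ≠ 0`), `P^{[d-1]} = Σ_i (γ - β₂)_i ∂ANF_Δ/∂y_i ≠ 0` (Cor 5.10 `sum_C_mul_pderiv_anf_ne_zero`);
  uniformity of `G` separates degrees (`bind₁_ne_zero_of_homogeneousComponent`, used ONCE) and the
  first-derivative engine `bind₁_affSubst_sum_C_mul_pderiv_anf_ne_zero` (Claim 5.15 for one
  derivative, `MS21ANFFirstDerivativeHitting`) hits `P^{[d-1]}(A₂x)`.  This is the printed step
  "if `ANF(My) = ANF(y)` … the polynomials differ only in the translation … `∂ANF/∂(β₁-β₂) ≠ 0` by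
  Cor 5.10 and Claim 5.15 applies" (arXiv p0030:L44–L55), run on the affine polynomial graded by the
  uniform map instead of on its homogenisation (route disclosed in `MS21ANFOrbitsDistinctDepthProofs`).
* **Linear-algebra dichotomy** (`exists_rowMatrix_of_offBlock_eq_zero`): if all off-block entries of
  `A₁A₂⁻¹` (rows `< 4^Δ`, columns `≥ 4^Δ`) vanish, the first `4^Δ` rows of `A₁` are the
  `M`-combinations of those of `A₂` for an INVERTIBLE `M` (the diagonal blocks of `A₁A₂⁻¹` and
  `A₂A₁⁻¹` are mutually inverse).
* **Reduction to the homogeneous core** (`MS2021_thm_35_of_core`): `MS2021_thm_35` follows from the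
  single remaining printed ingredient, stated as an explicit HYPOTHESIS (not a definition, not a fact):
  for `M ∈ GL_{4^Δ}(F)` with `ANF_Δ(My) ≠ ANF_Δ(y)` and `A ∈ GL_n(F)`, every uniform
  `(2Δ+7)`-independent `G` hits `(ANF_Δ(My) - ANF_Δ(y))(Ax)` — the content of Lemmas 5.12–5.15 and
  Claim `pitRoanfSame` of [MS21, §5.2] (arXiv p0027:L32–p0031:L24), in flight in sibling files.
  The proof of the reduction is the case analysis of the printed proof (p0030:L28–L43): `Δ₁ ≠ Δ₂`
  (`MS2021_thm_35_of_ne`); spans differ (`MS2021_thm_35_of_offBlock`); spans equal and `M` a symmetry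
  (`MS2021_thm_35_of_rowSpan_symm`); else the top homogeneous component `f^{[d]} =
  (ANF(My) - ANF(y))(A₂x)` is the core.

HONEST FRAMING: partial progress, by name, on the typed literature statement `MS2021_thm_35`; the
core hypothesis of `MS2021_thm_35_of_core` is NOT proved here.  `VP ≠ VNP` is NOT proved and nothing
in this file bears on it.

## References
* [MediniShpilka2021] D. Medini, A. Shpilka, *Hitting sets and reconstruction for dense orbits in
  VP_e and ΣΠΣ circuits*, CCC 2021 (LIPIcs 200:19) = arXiv:2102.05632: Thm 35 / ‹thm:pitRoanf›
  (CCC p.19:13; arXiv p0008:L29–30), its proof §5.2 (arXiv p0030:L28–p0031:L24), Cor 5.10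
  (p0025:L65–L70), Claim 5.15 (p0029:L1–L30), §1.1.6 (CCC p.19:9).
* Euler's homogeneous-function identity: Mathlib `MvPolynomial.IsHomogeneous.sum_X_mul_pderiv`.
-/

noncomputable section

open MvPolynomial
open scoped Matrix

namespace Literature.Computability.AlgebraicComplexity

namespace MS2021

/-! ### Affine substitutions: translations, compositions, grading -/

section AffineBookkeeping

variable {K : Type*} [Field K] {m n : ℕ}

/-- `Σ_k δ_{jk} x_k = x_j`. [folklore] -/
private theorem sum_C_one_mul_X (j : Fin m) :
    (∑ k : Fin m, C ((1 : Matrix (Fin m) (Fin m) K) j k) * X k : MvPolynomial (Fin m) K) = X j := by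
  have hk : ∀ k : Fin m, (C ((1 : Matrix (Fin m) (Fin m) K) j k) * X k : MvPolynomial (Fin m) K) =
      if j = k then X k else 0 := by
    intro k
    rw [Matrix.one_apply]
    split_ifs <;> simp
  simp_rw [hk]
  rw [Finset.sum_ite_eq]
  simp

/-- The translation `y ↦ y + β` on a variable: `(affSubst 1 β) x_i = x_i + β_i`.
[cite: MediniShpilka2021, §1.1.6 (CCC p.19:9)] -/
theorem affSubst_one_X (β : Fin m → K) (i : Fin m) :
    affSubst le_rfl 1 β (X i : MvPolynomial (Fin m) K) = X i + C (β i) := by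
  simp only [affSubst, aeval_X, Fin.castLE_rfl, id_eq]
  rw [sum_C_one_mul_X]
  rfl

/-- Chain rule for a pure translation: `∂_j (g(y + β)) = (∂_j g)(y + β)`.
[cite: MediniShpilka2021, Def 3.6 (chain rule display; arXiv p0017:L49-L51)] -/
theorem pderiv_affSubst_one (β : Fin m → K) (g : MvPolynomial (Fin m) K) (j : Fin m) :
    pderiv j (affSubst le_rfl 1 β g) = affSubst le_rfl 1 β (pderiv j g) := by
  rw [pderiv_affSubst]
  have hw : ∀ w : Fin m, affSubst le_rfl 1 β (pderiv w g) *
      C ((1 : Matrix (Fin m) (Fin m) K) (Fin.castLE le_rfl w) j) =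
      if w = j then affSubst le_rfl 1 β (pderiv j g) else 0 := by
    intro w
    rw [Fin.castLE_rfl, id_eq, Matrix.one_apply]
    split_ifs with hwj
    · subst hwj; rw [C_1, mul_one]
    · rw [C_0, mul_zero]
  simp_rw [hw]
  rw [Finset.sum_ite_eq']
  simp

/-- `affSubst` is additive-group compatible: differences (`f ↦ f(Ax+b)` is a ring map).
[cite: MediniShpilka2021, §1.1.6 (CCC p.19:9)] -/
theorem affSubst_sub (h : m ≤ n) (A : Matrix (Fin n) (Fin n) K) (b : Fin n → K)
    (p q : MvPolynomial (Fin m) K) :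
    affSubst h A b (p - q) = affSubst h A b p - affSubst h A b q := by
  simp only [affSubst, map_sub]

/-- **Rows in a common span**: if the first `m` rows of `A₁` are the `M`-combinations of the first
`m` rows of `A₂` (`A₁[i,·] = Σ_j M_{ij} A₂[j,·]` for `i, j < m`), then
`g(A₁x + b₁) = P(A₂x)` with `P(y) := g(My + β₁)`, `β₁ := b₁|_{<m}`.
[cite: MediniShpilka2021, proof of Thm 35, "`T₂(x) = (m(x), …)`, `T₁(x) = (M m(x), …)`" (arXiv p0030:L38–L43)] -/
theorem affSubst_eq_affSubst_zero_affSubst (h : m ≤ n) {A₁ A₂ : Matrix (Fin n) (Fin n) K}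
    (b₁ : Fin n → K) (M : Matrix (Fin m) (Fin m) K)
    (hrows : ∀ (i : Fin m) (k : Fin n), A₁ (Fin.castLE h i) k = ∑ j, M i j * A₂ (Fin.castLE h j) k)
    (g : MvPolynomial (Fin m) K) :
    affSubst h A₁ b₁ g =
      affSubst h A₂ 0 (affSubst le_rfl M (fun i => b₁ (Fin.castLE h i)) g) := by
  simp only [affSubst]
  rw [← AlgHom.comp_apply, comp_aeval]
  congr 2
  funext i
  simp only [map_add, map_sum, map_mul, aeval_C, aeval_X, Fin.castLE_rfl, id_eq, Pi.zero_apply,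
    C_0, add_zero, algebraMap_eq]
  congr 1
  simp_rw [hrows, map_sum, Finset.sum_mul, Finset.mul_sum]
  rw [Finset.sum_comm]
  refine Finset.sum_congr rfl fun j _ => Finset.sum_congr rfl fun k _ => ?_
  rw [map_mul, mul_assoc]

/-- **Composition of a linear map and a translation**: `(y ↦ y + γ)` applied after `y ↦ My` is
`y ↦ My + Mγ`, i.e. `g(M(y + γ)) = g(My + Mγ)`. [cite: MediniShpilka2021, §1.1.6 (CCC p.19:9); proof
of Thm 35, arXiv p0030:L44–L47] -/
theorem affSubst_one_affSubst_zero (γ : Fin m → K) (M : Matrix (Fin m) (Fin m) K)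
    (g : MvPolynomial (Fin m) K) :
    affSubst le_rfl 1 γ (affSubst le_rfl M 0 g) = affSubst le_rfl M (M *ᵥ γ) g := by
  simp only [affSubst]
  rw [← AlgHom.comp_apply, comp_aeval]
  congr 2
  funext i
  simp only [map_sum, map_mul, aeval_C, aeval_X, Fin.castLE_rfl, id_eq, Pi.zero_apply,
    C_0, add_zero, algebraMap_eq]
  simp_rw [sum_C_one_mul_X]
  simp only [Matrix.mulVec, dotProduct, map_sum, map_mul]
  rw [← Finset.sum_add_distrib]
  refine Finset.sum_congr rfl fun j _ => ?_
  rw [mul_add]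
  rfl

/-- **Linear substitutions respect the grading**: `[P(Ax)]_j = P^{[j]}(Ax)`.
[cite: MediniShpilka2021, Obs 2.1 (arXiv p0014:L27); proof of Thm 45 (p0036:L5-L8)] -/
theorem homogeneousComponent_affSubst_zero (h : m ≤ n) (A : Matrix (Fin n) (Fin n) K)
    (P : MvPolynomial (Fin m) K) (j : ℕ) :
    homogeneousComponent j (affSubst h A 0 P) = affSubst h A 0 (homogeneousComponent j P) := by
  have hL : ∀ i : Fin m, ((∑ k : Fin n, C (A (Fin.castLE h i) k) * X k) +
      C ((0 : Fin n → K) (Fin.castLE h i)) : MvPolynomial (Fin n) K).IsHomogeneous 1 := by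
    intro i
    rw [Pi.zero_apply, C_0, add_zero]
    exact IsHomogeneous.sum _ _ _ fun k _ => isHomogeneous_C_mul_X _ _
  simp only [affSubst]
  rw [aeval_eq_bind₁]
  have key := homogeneousComponent_bind₁_of_isHomogeneous hL Nat.one_pos P j
  rwa [one_mul] at key

end AffineBookkeeping

/-! ### First-order Taylor components via Euler's identity -/

section Taylor

variable {K : Type*} [Field K] {m : ℕ}

/-- **Euler's identity on homogeneous components**: `[Σ_i y_i ∂_i F]_j = j · F^{[j]}` (Mathlib
`IsHomogeneous.sum_X_mul_pderiv` componentwise; the graded book-keeping behind "`h^{[d-1]}`" in the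
proof of Thm 35). [cite: MediniShpilka2021, Obs 2.1 (arXiv p0014:L27) and proof of Thm 35 (arXiv p0030:L48–L52)] -/
theorem homogeneousComponent_sum_X_mul_pderiv {σ : Type*} [Fintype σ] (F : MvPolynomial σ K)
    (j : ℕ) : homogeneousComponent j (∑ i, X i * pderiv i F) = j • homogeneousComponent j F := by
  classical
  have key : (∑ i, X i * pderiv i F) =
      ∑ k ∈ Finset.range (F.totalDegree + 1), k • homogeneousComponent k F := by
    conv_lhs => rw [← sum_homogeneousComponent F]
    simp_rw [map_sum, Finset.mul_sum]
    rw [Finset.sum_comm]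
    refine Finset.sum_congr rfl fun k _ => ?_
    exact (homogeneousComponent_isHomogeneous k F).sum_X_mul_pderiv
  rw [key, map_sum]
  simp_rw [map_nsmul]
  rw [Finset.sum_eq_single j]
  · rw [homogeneousComponent_of_mem (homogeneousComponent_isHomogeneous j F), if_pos rfl]
  · intro k _ hk
    rw [homogeneousComponent_of_mem (homogeneousComponent_isHomogeneous k F), if_neg (Ne.symm hk),
      smul_zero]
  · intro hj
    rw [Finset.mem_range, not_lt] at hj
    rw [homogeneousComponent_eq_zero j F (by omega), map_zero, smul_zero]

/-- **First-order Taylor component of a translate.** For `g` homogeneous of degree `d + 1` and a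
translation `β`, the degree-`d` component of `g(y + β)` is the directional derivative
`Σ_i β_i ∂g/∂y_i`.  Proof: Euler's identity `Σ_i y_i ∂_i g = (d+1)·g` translated reads
`Σ_i y_i ∂_i F + Σ_i β_i (∂_i g)(y + β) = (d+1)·F` (`F := g(y+β)`); in degree `d` this is
`d·F_d + Σ_i β_i ∂_i g = (d+1)·F_d`.
[cite: MediniShpilka2021, proof of Thm 35 (arXiv p0030:L48–L52: "`h^{[d-1]}` … `∂ANF_Δ/∂(β₁ - β₂)`")] -/
theorem homogeneousComponent_affSubst_one {d : ℕ} (β : Fin m → K) {g : MvPolynomial (Fin m) K}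
    (hg : g.IsHomogeneous (d + 1)) :
    homogeneousComponent d (affSubst le_rfl 1 β g) = ∑ i, C (β i) * pderiv i g := by
  -- the substituted forms
  set L : Fin m → MvPolynomial (Fin m) K := fun i =>
    (∑ j : Fin m, C ((1 : Matrix (Fin m) (Fin m) K) (Fin.castLE le_rfl i) j) * X j) +
      C (β (Fin.castLE le_rfl i)) with hLdef
  have hφ : ∀ p : MvPolynomial (Fin m) K, affSubst le_rfl 1 β p = aeval L p := fun p => rfl
  have hL : ∀ i, L i = X i + C (β i) := fun i => by rw [← affSubst_one_X β i, hφ, aeval_X]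
  -- Euler upstairs, translated
  have h1 : (∑ i, (X i + C (β i)) * aeval L (pderiv i g)) = (d + 1) • aeval L g := by
    have e := congrArg (aeval L) hg.sum_X_mul_pderiv
    rw [map_sum, map_nsmul] at e
    simp_rw [map_mul, aeval_X, hL] at e
    exact e
  have h2 : (∑ i, X i * pderiv i (aeval L g)) + ∑ i, C (β i) * aeval L (pderiv i g) =
      (d + 1) • aeval L g := by
    rw [← h1, ← Finset.sum_add_distrib]
    refine Finset.sum_congr rfl fun i _ => ?_
    rw [add_mul, ← hφ, ← hφ, pderiv_affSubst_one]
  -- degree-`d` components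
  have h3 := congrArg (homogeneousComponent d) h2
  rw [map_add, map_nsmul, homogeneousComponent_sum_X_mul_pderiv, map_sum] at h3
  have h4 : ∀ i, homogeneousComponent d (C (β i) * aeval L (pderiv i g)) = C (β i) * pderiv i g := by
    intro i
    have hgi : (pderiv i g).IsHomogeneous d := by
      have := hg.pderiv (i := i)
      rwa [Nat.add_sub_cancel] at this
    rw [homogeneousComponent_C_mul, ← hφ, homogeneousComponent_affSubst le_rfl 1 β hgi,
      affSubst_one_zero]
  simp_rw [h4] at h3
  rw [succ_nsmul, ← hφ] at h3
  exact (add_left_cancel h3).symm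

end Taylor

/-! ### Linear algebra of the equal-span case -/

section RowSpan

variable {K : Type*} [Field K] {m n : ℕ}

/-- A sum over `Fin n` whose terms vanish at the indices `≥ m` is the sum over `castLE`.
[folklore] -/
private theorem sum_eq_sum_castLE (h : m ≤ n) {β : Type*} [AddCommMonoid β] (F : Fin n → β)
    (hF : ∀ l : Fin n, m ≤ (l : ℕ) → F l = 0) : ∑ l, F l = ∑ j : Fin m, F (Fin.castLE h j) := by
  classical
  have hmap : ∑ j : Fin m, F (Fin.castLE h j) = ∑ l ∈ Finset.univ.map (Fin.castLEEmb h), F l := by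
    rw [Finset.sum_map]
    rfl
  rw [hmap]
  symm
  apply Finset.sum_subset (Finset.subset_univ _)
  intro l _ hl
  apply hF
  by_contra hlt
  push Not at hlt
  exact hl (Finset.mem_map.mpr ⟨⟨l, hlt⟩, Finset.mem_univ _, Fin.ext rfl⟩)

/-- **Equal spans.** If every off-block entry (row `< m`, column `≥ m`) of `A₁A₂⁻¹` vanishes, then
the first `m` rows of `A₁` are the `M`-combinations of the first `m` rows of `A₂` for an invertible
`M` (the top-left blocks of `A₁A₂⁻¹` and `A₂A₁⁻¹` are mutually inverse, since the off-block of the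
first factor vanishes) ("both `T₁` and `T₂` are supported on the same set of `4^Δ` linear functions …
`T₁(x) = (M m(x), …)`"). [cite: MediniShpilka2021, proof of Thm 35 (arXiv p0030:L38–L43)] -/
theorem exists_rowMatrix_of_offBlock_eq_zero (h : m ≤ n) {A₁ A₂ : Matrix (Fin n) (Fin n) K}
    (hA₁ : IsUnit A₁.det) (hA₂ : IsUnit A₂.det)
    (h₁₂ : ∀ (i : Fin m) (l : Fin n), m ≤ (l : ℕ) → (A₁ * A₂⁻¹) (Fin.castLE h i) l = 0) :
    ∃ M : Matrix (Fin m) (Fin m) K, IsUnit M.det ∧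
      ∀ (i : Fin m) (k : Fin n), A₁ (Fin.castLE h i) k = ∑ j, M i j * A₂ (Fin.castLE h j) k := by
  classical
  refine ⟨fun i j => (A₁ * A₂⁻¹) (Fin.castLE h i) (Fin.castLE h j), ?_, ?_⟩
  · apply Matrix.isUnit_det_of_right_inverse
      (B := fun i j => (A₂ * A₁⁻¹) (Fin.castLE h i) (Fin.castLE h j))
    ext i j
    rw [Matrix.mul_apply]
    have hsum := sum_eq_sum_castLE h
      (fun l => (A₁ * A₂⁻¹) (Fin.castLE h i) l * (A₂ * A₁⁻¹) l (Fin.castLE h j))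
      (fun l hl => by rw [h₁₂ i l hl, zero_mul])
    have hprod : (A₁ * A₂⁻¹) * (A₂ * A₁⁻¹) = 1 := by
      rw [Matrix.mul_assoc, Matrix.nonsing_inv_mul_cancel_left A₂ _ hA₂, Matrix.mul_nonsing_inv A₁ hA₁]
    have h1 := congrFun (congrFun hprod (Fin.castLE h i)) (Fin.castLE h j)
    rw [Matrix.mul_apply, hsum] at h1
    rw [h1]
    simp only [Matrix.one_apply, (Fin.castLE_injective h).eq_iff]
  · intro i k
    have e : A₁ (Fin.castLE h i) k = (A₁ * A₂⁻¹ * A₂) (Fin.castLE h i) k := by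
      rw [Matrix.nonsing_inv_mul_cancel_right A₂ A₁ hA₂]
    rw [e, Matrix.mul_apply]
    exact sum_eq_sum_castLE h _ (fun l hl => by rw [h₁₂ i l hl, zero_mul])

end RowSpan

/-! ### Case B2: equal spans and a symmetry of `ANF_Δ` -/

section EqualSpan

variable {K : Type} [Field K] {n c : ℕ}

/-- **Case B2 of MS Thm 35 (`Δ₁ = Δ₂ = Δ`)**: the `x`-spans of the two affine maps agree
(`A₁|_{<4^Δ} = M · A₂|_{<4^Δ}`, `M` invertible) and `M` is a symmetry of `ANF_Δ`
(`ANF_Δ(My) = ANF_Δ(y)`).  Then `f = ANF(A₂x|_{<4^Δ} + γ) - ANF(A₂x|_{<4^Δ} + β₂)` with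
`γ = M⁻¹β₁ ≠ β₂`, its degree-`(2^Δ - 1)` component is `(Σ_i (γ-β₂)_i ∂ANF_Δ/∂y_i)(A₂x) ≠ 0`
(Cor 5.10), which every uniform `(2Δ+7)`-independent `G` hits (Claim 5.15 for one derivative) —
hence `f ∘ G ≠ 0` by degree separation under the uniform `G`.
[cite: MediniShpilka2021, Thm 35 and its proof, case "`ANF(My) = ANF(y)`" (arXiv p0030:L44–L55);
Cor 5.10 (p0025:L65–L70); Claim 5.15 (p0029:L1–L30)] -/
theorem bind₁_anf_affSubst_sub_ne_zero_of_rowSpan_symm {Δ : ℕ} (h : 4 ^ Δ ≤ n)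
    {A₁ A₂ : Matrix (Fin n) (Fin n) K} (hA₂ : IsUnit A₂.det) (b₁ b₂ : Fin n → K)
    (M : Matrix (Fin (4 ^ Δ)) (Fin (4 ^ Δ)) K) (hM : IsUnit M.det)
    (hrows : ∀ (i : Fin (4 ^ Δ)) (k : Fin n),
      A₁ (Fin.castLE h i) k = ∑ j, M i j * A₂ (Fin.castLE h j) k)
    (hsym : affSubst le_rfl M 0 (anf K Δ) = anf K Δ)
    (hne : affSubst h A₁ b₁ (anf K Δ) - affSubst h A₂ b₂ (anf K Δ) ≠ 0)
    (G : Fin n → MvPolynomial (Fin (2 * max Δ Δ + 7) × (Fin c ⊕ Unit)) K)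
    (hG : IsIndependent (2 * max Δ Δ + 7) G) (hU : IsUniform G) :
    bind₁ G (affSubst h A₁ b₁ (anf K Δ) - affSubst h A₂ b₂ (anf K Δ)) ≠ 0 := by
  classical
  -- the two translations seen through `A₂`
  set γ : Fin (4 ^ Δ) → K := M⁻¹ *ᵥ fun i => b₁ (Fin.castLE h i) with hγ
  set β₂ : Fin (4 ^ Δ) → K := fun i => b₂ (Fin.castLE h i) with hβ₂
  have hone : ∀ (i : Fin (4 ^ Δ)) (k : Fin n),
      A₂ (Fin.castLE h i) k = ∑ j, (1 : Matrix _ _ K) i j * A₂ (Fin.castLE h j) k := by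
    intro i k
    simp_rw [Matrix.one_apply, ite_mul, one_mul, zero_mul]
    rw [Finset.sum_ite_eq]
    simp
  -- `ANF(My + β₁) = ANF(y + γ)` by the symmetry
  have hf₁ : affSubst h A₁ b₁ (anf K Δ) = affSubst h A₂ 0 (affSubst le_rfl 1 γ (anf K Δ)) := by
    rw [affSubst_eq_affSubst_zero_affSubst h b₁ M hrows, ← hsym, affSubst_one_affSubst_zero, hsym,
      hγ, Matrix.mulVec_mulVec, Matrix.mul_nonsing_inv M hM, Matrix.one_mulVec]
  have hf₂ : affSubst h A₂ b₂ (anf K Δ) = affSubst h A₂ 0 (affSubst le_rfl 1 β₂ (anf K Δ)) :=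
    affSubst_eq_affSubst_zero_affSubst h b₂ 1 hone (anf K Δ)
  set P : MvPolynomial (Fin (4 ^ Δ)) K :=
    affSubst le_rfl 1 γ (anf K Δ) - affSubst le_rfl 1 β₂ (anf K Δ) with hP
  have hf : affSubst h A₁ b₁ (anf K Δ) - affSubst h A₂ b₂ (anf K Δ) = affSubst h A₂ 0 P := by
    rw [hf₁, hf₂, hP, affSubst_sub]
  -- the translations differ
  have hu : γ - β₂ ≠ 0 := by
    intro h0
    apply hne
    rw [hf, hP, sub_eq_zero.mp h0, sub_self]
    simp only [affSubst, map_zero]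
  -- the degree-`(2^Δ - 1)` component of `P`
  have hanf : (anf K Δ).IsHomogeneous (2 ^ Δ - 1 + 1) := by
    rw [Nat.sub_add_cancel Nat.one_le_two_pow]
    exact isHomogeneous_anf K Δ
  have hcomp : homogeneousComponent (2 ^ Δ - 1) P =
      ∑ i, C ((γ - β₂) i) * pderiv i (anf K Δ) := by
    rw [hP, map_sub, homogeneousComponent_affSubst_one γ hanf,
      homogeneousComponent_affSubst_one β₂ hanf, ← Finset.sum_sub_distrib]
    refine Finset.sum_congr rfl fun i _ => ?_
    rw [Pi.sub_apply, map_sub, sub_mul]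
  -- degree separation under the uniform `G`, then the first-derivative engine
  have hn : 0 < n := lt_of_lt_of_le (Nat.one_le_pow _ _ (by norm_num)) h
  obtain ⟨e, he, hGe⟩ := exists_pos_isHomogeneous_of_isUniform hG hU (by omega) ⟨0, hn⟩
  refine bind₁_ne_zero_of_homogeneousComponent hGe he (j := 2 ^ Δ - 1) ?_
  rw [hf, homogeneousComponent_affSubst_zero, hcomp]
  have ht : 4 ^ Δ ≤ 2 ^ (2 * Δ) := by rw [pow_mul]; norm_num
  exact bind₁_affSubst_sum_C_mul_pderiv_anf_ne_zero (γ - β₂) hu h hA₂ 0 ht G hG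
    (by rw [max_self]; omega)

end EqualSpan

end MS2021

/-! ### The reduction of `MS2021_thm_35` to its homogeneous core -/

section Reduction

open MS2021

/-- **MS Thm 35, Case B2 (equal spans, `M` a symmetry of `ANF_Δ`)**, in the binders of the typed
statement. [cite: MediniShpilka2021, Thm 35 (CCC p.19:13; arXiv p0008:L29-30); proof, case
"`ANF(My) = ANF(y)`" (arXiv p0030:L44–L55)] -/
theorem MS2021_thm_35_of_rowSpan_symm (K : Type) [Field K] (n Δ c : ℕ) (h : 4 ^ Δ ≤ n)
    {A₁ A₂ : Matrix (Fin n) (Fin n) K} (hA₂ : IsUnit A₂.det) (b₁ b₂ : Fin n → K)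
    (M : Matrix (Fin (4 ^ Δ)) (Fin (4 ^ Δ)) K) (hM : IsUnit M.det)
    (hrows : ∀ (i : Fin (4 ^ Δ)) (k : Fin n),
      A₁ (Fin.castLE h i) k = ∑ j, M i j * A₂ (Fin.castLE h j) k)
    (hsym : affSubst le_rfl M 0 (anf K Δ) = anf K Δ)
    (hne : affSubst h A₁ b₁ (anf K Δ) - affSubst h A₂ b₂ (anf K Δ) ≠ 0)
    (G : Fin n → MvPolynomial (Fin (2 * max Δ Δ + 7) × (Fin c ⊕ Unit)) K)
    (hG : IsIndependent (2 * max Δ Δ + 7) G) (hU : IsUniform G) :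
    bind₁ G (affSubst h A₁ b₁ (anf K Δ) - affSubst h A₂ b₂ (anf K Δ)) ≠ 0 :=
  bind₁_anf_affSubst_sub_ne_zero_of_rowSpan_symm h hA₂ b₁ b₂ M hM hrows hsym hne G hG hU

/-- **Reduction of MS Thm 35 to its homogeneous core.**  The typed statement `MS2021_thm_35` follows
from the single remaining printed ingredient, taken here as an explicit HYPOTHESIS `hcore` (it is
the content of Lemmas 5.12–5.15 and Claim `pitRoanfSame` of [MS21, §5.2]): for every
`M ∈ GL_{4^Δ}(F)` that is NOT a symmetry of `ANF_Δ` and every `A ∈ GL_n(F)`, every uniform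
`(2Δ+7)`-independent `G` hits `(ANF_Δ(My) - ANF_Δ(y))(Ax|_{<4^Δ})`.  The proof is the case analysis
of the printed proof: `Δ₁ ≠ Δ₂` (`MS2021_thm_35_of_ne`); `Δ₁ = Δ₂` and the spans differ
(`MS2021_thm_35_of_offBlock`); spans equal (`exists_rowMatrix_of_offBlock_eq_zero`) and `M` a
symmetry (`MS2021_thm_35_of_rowSpan_symm`); otherwise the top component
`f^{[2^Δ]} = (ANF(My) - ANF(y))(A₂x)` is nonzero-after-`G` by `hcore`, and degree separation under the
uniform `G` concludes. [cite: MediniShpilka2021, Thm 35 (CCC p.19:13; arXiv p0008:L29-30) and its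
proof (arXiv p0030:L28–p0031:L24)] -/
theorem MS2021_thm_35_of_core
    (hcore : ∀ (K : Type) [Field K] (n Δ c : ℕ) (h : 4 ^ Δ ≤ n) (A : Matrix (Fin n) (Fin n) K),
      IsUnit A.det → ∀ M : Matrix (Fin (4 ^ Δ)) (Fin (4 ^ Δ)) K, IsUnit M.det →
      affSubst le_rfl M 0 (anf K Δ) ≠ anf K Δ →
      ∀ G : Fin n → MvPolynomial (Fin (2 * max Δ Δ + 7) × (Fin c ⊕ Unit)) K,
        IsIndependent (2 * max Δ Δ + 7) G → IsUniform G →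
        bind₁ G (affSubst h A 0 (affSubst le_rfl M 0 (anf K Δ) - anf K Δ)) ≠ 0) :
    MS2021_thm_35 := by
  intro K _ n Δ₁ Δ₂ c f₁ hf₁ f₂ hf₂ hne G hG hU
  by_cases hΔ : Δ₁ = Δ₂
  swap
  · exact MS2021_thm_35_of_ne K n Δ₁ Δ₂ c hΔ f₁ hf₁ f₂ hf₂ hne G hG hU
  subst hΔ
  obtain ⟨h, A₁, b₁, hA₁, rfl⟩ := hf₁
  obtain ⟨h', A₂, b₂, hA₂, rfl⟩ := hf₂
  have hh : affSubst h' A₂ b₂ (anf K Δ₁) = affSubst h A₂ b₂ (anf K Δ₁) := rfl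
  rw [hh] at hne ⊢
  classical
  by_cases hoff : ∃ (i₀ : Fin (4 ^ Δ₁)) (j₁ : Fin n), 4 ^ Δ₁ ≤ (j₁ : ℕ) ∧
      ((A₁ * A₂⁻¹) (Fin.castLE h i₀) j₁ ≠ 0 ∨ (A₂ * A₁⁻¹) (Fin.castLE h i₀) j₁ ≠ 0)
  · exact MS2021_thm_35_of_offBlock K n Δ₁ c h hA₁ hA₂ b₁ b₂ hoff G hG
  push Not at hoff
  obtain ⟨M, hM, hrows⟩ := exists_rowMatrix_of_offBlock_eq_zero h hA₁ hA₂
    (fun i l hl => (hoff i l hl).1)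
  by_cases hsym : affSubst le_rfl M 0 (anf K Δ₁) = anf K Δ₁
  · exact MS2021_thm_35_of_rowSpan_symm K n Δ₁ c h hA₂ b₁ b₂ M hM hrows hsym hne G hG hU
  -- Case B1: the top homogeneous component is the core
  have hn : 0 < n := lt_of_lt_of_le (Nat.one_le_pow _ _ (by norm_num)) h
  obtain ⟨e, he, hGe⟩ := exists_pos_isHomogeneous_of_isUniform hG hU (by omega) ⟨0, hn⟩
  refine bind₁_ne_zero_of_homogeneousComponent hGe he (j := 2 ^ Δ₁) ?_
  have h0 : (fun i : Fin (4 ^ Δ₁) => (0 : Fin n → K) (Fin.castLE h i)) = 0 := rfl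
  rw [map_sub, homogeneousComponent_affSubst h A₁ b₁ (isHomogeneous_anf K Δ₁),
    homogeneousComponent_affSubst h A₂ b₂ (isHomogeneous_anf K Δ₁),
    affSubst_eq_affSubst_zero_affSubst h 0 M hrows (anf K Δ₁), h0, ← affSubst_sub]
  exact hcore K n Δ₁ c h A₂ hA₂ M hM hsym G hG hU

end Reduction

end Literature.Computability.AlgebraicComplexity

end
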